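import Literature.Analysis.FluidPDE.TaoMildSolutionBounds

/-!
# Crux `PerpetualPump.AveragedTypeIBlowup` (stmt-NavierStokesRegularity-1835), line `Sketch`:
# stub `noext` — wavelet coefficients unbounded in the `H¹⁰` weight forbid every mild extension

The crux asks (among other things) for an `H¹⁰_df`-mild solution `u` on `[0,S)` with NO mild
extension past `S`. The line `Sketch` builds `u` for a Tao cascade equation `∂ₜu = Δu + C(u,u)`
(Tao 2016, §4, (4.1)/(3.3)) from an exact chain solution whose wavelet coefficients
`X_{i,n}(t) = Re ⟨u(t), ψ_{i,n}⟩` (`modeCoeff`) blow up at `S` in the `H¹⁰` weight `(1+ε₀)^{10n}`.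
This file discharges the NON-EXTENSION conjunct, for a general trilinear form `T`:

* `mildExtension_H10_bounded` — a mild extension `v` on `[0,S')`, `S < S'`, agreeing with `u` on
  `[0,S)` forces `sup_{t<S} ‖u(t)‖_{H¹⁰} < ∞`: `t ↦ ‖v(t)‖_{H¹⁰}` is continuous on `Ico 0 S'`
  (`ContinuousInH10On.continuousOn_toReal`) hence bounded on the compact `[0,S] ⊆ Ico 0 S'`
  (same argument as the landed `…AveragedTypeIBlowup.Negative.extension_H10_bounded`, which is the
  special case `T = 𝒜.form`). No uniqueness of mild solutions is used.
* `weight_mul_decay_le_one` — `(1+ε₀)^{10n} (1 + (1+ε₀)^{2n})^{-5} ≤ 1`.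
* `weight_mul_abs_modeCoeff_le` — Tao's (4.6) in the prover's form:
  `(1+ε₀)^{10n} |X_{i,n}(t)| ≤ ‖u(t)‖_{H¹⁰}` (from the accepted Fourier-side Cauchy–Schwarz bound
  `CascadeWaveletData.enorm_pairing_cascadeWavelet_le`).
* `stub_noext` — the registered stub: coefficients unbounded in the weight on `[0,S)` ⇒ no mild
  extension past `S`.

Nothing here closes the item (`--supports`); no statement of the route changes; the route decl is
deliberately not imported.

## References

* T. Tao, *Finite time blowup for an averaged three-dimensional Navier–Stokes equation*, J. Amer.
  Math. Soc. 29 (2016), 601–674 = arXiv:1402.0290v3, §4, Lemma 4.1 (4.6), p. 22.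
  [`Tao2016AveragedNS`]
-/

noncomputable section

-- the summit namespace `…NavierStokesRegularity.NavierStokesRegularity…` is the tree convention
set_option linter.dupNamespace false

open MeasureTheory Set Filter Topology
open scoped ENNReal
open Literature.Analysis.FluidPDE Literature.Analysis.FluidPDE.Tao2016
open Literature.Analysis.FluidPDE.TaoCascade (quadTerm IsSymmetricCoeff IsCancellingCoeff)

namespace Summit.NavierStokesRegularity.NavierStokesRegularity.Theorems.PerpetualPumpAveragedTypeIBlowup

/-- **A mild extension past `S` forces `H¹⁰`-boundedness up to `S`** (any trilinear form `T`, any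
datum `a`). If `v` is a mild solution on `[0,S')`, `S < S'`, agreeing with `u` on `[0,S)`, then
`‖u(t)‖_{H¹⁰} ≤ C` on `[0,S)` for some `C ≥ 0`: the real function `t ↦ ‖v(t)‖_{H¹⁰}` is continuous
on `Ico 0 S'` hence bounded on the compact `[0,S] ⊆ Ico 0 S'`. [folklore] -/
theorem mildExtension_H10_bounded {T : L2C → L2C → L2C → ℂ} {a : L2C} {S S' : ℝ} (hSS' : S < S')
    {u v : ℝ → L2C} (hv : IsMildSolutionFor T a (Ico 0 S') v) (huv : ∀ t ∈ Ico 0 S, v t = u t) :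
    ∃ C : ℝ, 0 ≤ C ∧ ∀ t ∈ Ico 0 S,
      Literature.Analysis.FunctionSpaces.eFourierSobolevNorm 10 (u t) ≤ ENNReal.ofReal C := by
  have hfin : ∀ t ∈ Ico 0 S',
      Literature.Analysis.FunctionSpaces.eFourierSobolevNorm 10 (v t) < ∞ :=
    fun t ht => (hv.1 t ht).1
  have hcont := hv.2.1.continuousOn_toReal hfin
  have hsub : Icc 0 S ⊆ Ico 0 S' := fun t ht => ⟨ht.1, ht.2.trans_lt hSS'⟩
  obtain ⟨C, hC⟩ := isCompact_Icc.exists_bound_of_continuousOn (hcont.mono hsub)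
  refine ⟨max C 0, le_max_right _ _, fun t ht => ?_⟩
  have htI : t ∈ Icc 0 S := ⟨ht.1, ht.2.le⟩
  have h := hC t htI
  rw [Real.norm_eq_abs, abs_le] at h
  rw [← huv t ht, ← ENNReal.ofReal_toReal (hfin t (hsub htI)).ne]
  exact ENNReal.ofReal_le_ofReal (h.2.trans (le_max_left _ _))

/-- The weight algebra behind (4.6): with `N = (1+ε₀)ⁿ > 0`,
`(1+ε₀)^{10n} (1 + N²)^{-5} = N^{10} / (1+N²)^5 ≤ 1`. [folklore] -/
theorem weight_mul_decay_le_one {ε₀ : ℝ} (hε : 0 < 1 + ε₀) (n : ℤ) :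
    (1 + ε₀) ^ ((10 : ℝ) * n) * (1 + ((1 + ε₀) ^ n) ^ 2) ^ (-(5 : ℝ)) ≤ 1 := by
  have hNpos : 0 < (1 + ε₀) ^ n := zpow_pos hε n
  have hW : (1 + ε₀) ^ ((10 : ℝ) * n) = ((1 + ε₀) ^ n) ^ 10 := by
    rw [mul_comm (10 : ℝ), Real.rpow_mul hε.le, Real.rpow_intCast, Real.rpow_ofNat]
  have hK : (1 + ((1 + ε₀) ^ n) ^ 2) ^ (-(5 : ℝ)) = ((1 + ((1 + ε₀) ^ n) ^ 2) ^ 5)⁻¹ := by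
    rw [Real.rpow_neg (by positivity), Real.rpow_ofNat]
  rw [hW, hK, ← div_eq_mul_inv, div_le_one (by positivity)]
  calc ((1 + ε₀) ^ n) ^ 10 = (((1 + ε₀) ^ n) ^ 2) ^ 5 := by ring
    _ ≤ (1 + ((1 + ε₀) ^ n) ^ 2) ^ 5 :=
        pow_le_pow_left₀ (sq_nonneg _) (le_add_of_nonneg_left zero_le_one) 5

/-- **Tao's (4.6), prover's form.** If `‖u(t)‖_{H¹⁰} ≤ C` (`C ≥ 0`) then
`(1+ε₀)^{10n} |X_{i,n}(t)| ≤ C`: `|X_{i,n}(t)| = |Re ⟨u(t), ψ_{i,n}⟩| ≤ |⟨u(t), ψ_{i,n}⟩| ≤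
(1 + (1+ε₀)^{2n})^{-5} ‖u(t)‖_{H¹⁰}` (accepted `enorm_pairing_cascadeWavelet_le`: `ψ̂_{i,n}` has
unit mass and lives where `|ξ| > (1+ε₀)ⁿ`), and `(1+ε₀)^{10n} (1 + (1+ε₀)^{2n})^{-5} ≤ 1`. [cite: Tao2016AveragedNS, §4 (4.6)] -/
theorem weight_mul_abs_modeCoeff_le {ε₀ : ℝ} (hε : 0 < 1 + ε₀) {m : ℕ} (𝒟 : CascadeWaveletData ε₀ m)
    (u : ℝ → L2C) (i : Fin m) (n : ℤ) (t : ℝ) {C : ℝ} (hC : 0 ≤ C)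
    (hu : Literature.Analysis.FunctionSpaces.eFourierSobolevNorm 10 (u t) ≤ ENNReal.ofReal C) :
    (1 + ε₀) ^ ((10 : ℝ) * n) * |modeCoeff 𝒟 u i n t| ≤ C := by
  have hK0 : 0 ≤ (1 + ((1 + ε₀) ^ n) ^ 2) ^ (-(5 : ℝ)) := Real.rpow_nonneg (by positivity) _
  -- the coefficient bound, transported from `ℝ≥0∞` to `ℝ`
  have h1 : ‖pairing (u t) (cascadeWavelet ε₀ (𝒟.ψ i) n)‖ ≤
      (1 + ((1 + ε₀) ^ n) ^ 2) ^ (-(5 : ℝ)) * C := by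
    rw [← ENNReal.ofReal_le_ofReal_iff (mul_nonneg hK0 hC), ofReal_norm, ENNReal.ofReal_mul hK0]
    exact (𝒟.enorm_pairing_cascadeWavelet_le hε i n (u t)).trans (mul_le_mul_right hu _)
  have hre : |modeCoeff 𝒟 u i n t| ≤ (1 + ((1 + ε₀) ^ n) ^ 2) ^ (-(5 : ℝ)) * C :=
    (Complex.abs_re_le_norm _).trans h1
  calc (1 + ε₀) ^ ((10 : ℝ) * n) * |modeCoeff 𝒟 u i n t|
      ≤ (1 + ε₀) ^ ((10 : ℝ) * n) * ((1 + ((1 + ε₀) ^ n) ^ 2) ^ (-(5 : ℝ)) * C) :=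
        mul_le_mul_of_nonneg_left hre (Real.rpow_nonneg hε.le _)
    _ = (1 + ε₀) ^ ((10 : ℝ) * n) * (1 + ((1 + ε₀) ^ n) ^ 2) ^ (-(5 : ℝ)) * C := by ring
    _ ≤ 1 * C := mul_le_mul_of_nonneg_right (weight_mul_decay_le_one hε n) hC
    _ = C := one_mul C

/-- **Stub `noext` (line `Sketch` of crux `AveragedTypeIBlowup`): the non-extension conjunct.**
For wavelet data `𝒟` at dyadic parameter `ε₀ > 0`, any trilinear form `T`, datum `a` and mild
solution `u` of `∂ₜu = Δu + T(u,u)` on `[0,S)`: if the wavelet coefficients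
`X_{i,n}(t) = Re ⟨u(t), ψ_{i,n}⟩` are unbounded on `[0,S)` in the `H¹⁰` weight `(1+ε₀)^{10n}`, then
`u` has NO mild extension past `S`. Indeed a mild extension `v` on `[0,S')`, `S < S'`, is
`H¹⁰`-continuous on `Ico 0 S' ⊇ [0,S]`, so `‖u(t)‖_{H¹⁰} = ‖v(t)‖_{H¹⁰} ≤ C` on `[0,S)`
(`mildExtension_H10_bounded`), whence `(1+ε₀)^{10n} |X_{i,n}(t)| ≤ C` there by Tao's a priori
bound (4.6) (`weight_mul_abs_modeCoeff_le`) — contradicting unboundedness. No uniqueness of mild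
solutions is needed. [cite: Tao2016AveragedNS, §4 (4.6)] -/
theorem stub_noext :
    ∀ {ε₀ : ℝ}, 0 < ε₀ → ∀ {m : ℕ} (𝒟 : CascadeWaveletData ε₀ m) (T : L2C → L2C → L2C → ℂ) (a : L2C)
      (S : ℝ) (u : ℝ → L2C), IsMildSolutionFor T a (Ico 0 S) u →
      (∀ C : ℝ, ∃ t ∈ Ico 0 S, ∃ (i : Fin m) (n : ℤ), C < (1 + ε₀) ^ ((10 : ℝ) * n) * |modeCoeff 𝒟 u i n t|) →
      ¬ ∃ S' : ℝ, S < S' ∧ ∃ v : ℝ → L2C, IsMildSolutionFor T a (Ico 0 S') v ∧ ∀ t ∈ Ico 0 S, v t = u t := by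
  intro ε₀ hε₀ m 𝒟 T a S u _hu hunb
  rintro ⟨S', hSS', v, hv, huv⟩
  have hε : 0 < 1 + ε₀ := by linarith
  obtain ⟨C, hC0, hC⟩ := mildExtension_H10_bounded hSS' hv huv
  obtain ⟨t, ht, i, n, hlt⟩ := hunb C
  exact absurd (weight_mul_abs_modeCoeff_le hε 𝒟 u i n t hC0 (hC t ht)) (not_le.mpr hlt)

end Summit.NavierStokesRegularity.NavierStokesRegularity.Theorems.PerpetualPumpAveragedTypeIBlowup

end
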